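import Literature.Analysis.SpecialFunctions.RiemannThetaHeatEquation
import Mathlib.Analysis.Calculus.IteratedDeriv.Defs
import HarnessLib

/-!
# `n`-th derivatives of `ϑ[a; b](·, Ω)` along a line are theta series with the polynomial weight
# `(2πi ᵗ(m+a)u)ⁿ` (Lange–Birkenhake Prop. 3.3.7: "we can differentiate the series term by term")

Topic `Literature/Analysis/SpecialFunctions`; namespace `Literature.Analysis.SpecialFunctions`.
Everything here is PROVED (theorems only; no definition, no named fact).  A sequel of
`RiemannThetaHeatEquation.lean` (termwise differentiation of WEIGHTED theta series
`Σ_m w(m) exp(πi ᵗ(m+a)Ω(m+a) + 2πi ᵗ(m+a)(z+b))` for weights of exponential-linear growth), iterated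
along a complex line `z = s·u`:

* `norm_lineWeightPow_le` — the polynomial weight `w_n(m) = (2πi ᵗ(m+a)u)ⁿ` has exponential-linear
  growth `‖w_n(m)‖ ≤ (2π Σᵢ(1+|aᵢ|)|uᵢ|)ⁿ exp(n Σᵢ|mᵢ|)`;
* `hasDerivAt_tsum_lineWeightPow_mul_riemannThetaCharTerm` — `d/ds Σ_m w_n(m) e_m(s u) = Σ_m w_{n+1}(m) e_m(s u)`
  (`e_m(z)` the general term `riemannThetaCharTerm a b Ω z m`; chain rule through `s ↦ s·u` and the
  tree's `fderiv_tsum_mul_riemannThetaCharTerm_apply`);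
* **`iteratedDeriv_riemannThetaChar_line`** — for symmetric `Ω` with `Im Ω ≥ c > 0` and all
  `a, b, u ∈ ℂ^g`, `n ∈ ℕ`:
  `(d/ds)ⁿ ϑ[a;b](s u, Ω) = Σ_m (2πi ᵗ(m+a)u)ⁿ exp(πi ᵗ(m+a)Ω(m+a) + 2πi ᵗ(m+a)(s u + b))` for every `s`;
* `iteratedDeriv_riemannThetaChar_line_zero` — at `s = 0`: the THETA SERIES WITH THE POLYNOMIAL
  `(2πi ᵗ(m+a)u)ⁿ` INSERTED, `Σ_m (2πi ᵗ(m+a)u)ⁿ exp(πi ᵗ(m+a)Ω(m+a) + 2πi ᵗ(m+a) b)`.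
* `hasSum_iteratedDeriv_riemannThetaChar_line` — the same as a `HasSum` statement;
* `iteratedDeriv_riemannThetaChar_line_eq_neg_char`, `iteratedDeriv_riemannThetaChar_zero_zero_line_eq_zero`
  — parity: `∂ⁿϑ[a; b](s u)|₀ = (-1)ⁿ ∂ⁿϑ[-a; -b](s u)|₀`, so the odd line derivatives of `ϑ[0; 0]`
  vanish at `0`.

With `BinaryThetaHigherWeight.lean` (the weight-`(n+1)` transformation law of `(d/ds)ⁿ ϑ[c](s u, τ·B)|₀`
for `u` isotropic) this identifies the binary theta series with the spherical polynomial `(ᵗ(m+a)u)ⁿ`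
(Hecke 1926 §3 / Schoeneberg 1939; for the norm form of an ideal of an imaginary quadratic field and
`u = (σ(b₁), σ(b₂))`, the polynomial `σ(x)ⁿ`) as a function with the weight-`(n+1)` law — a brick of the
weight-`k` Hecke theta series (the input `X_k` of `Ribet1977_cmNewform_gamma0_of_isGrossencharakter`).

## References

* H. Lange, C. Birkenhake, *Complex Abelian Varieties* (1992), §3.3.2 Prop. 3.3.6–3.3.7
  (holomorphy and termwise differentiation of `ϑ[c¹; c²]`). [LangeBirkenhake1992]
* E. Hecke, *Zur Theorie der elliptischen Modulfunktionen*, Math. Ann. 97 (1926), §3. [Hecke1926Modulfunktionen]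
-/

noncomputable section

open Matrix Complex Filter Topology Set Finset

open scoped Real

namespace Literature.Analysis.SpecialFunctions

variable {g : ℕ}

/-! ### The polynomial weight `(2πi ᵗ(m+a)u)ⁿ` has exponential-linear growth -/

/-- `|mⱼ| ≤ Σᵢ |mᵢ|`. [folklore] -/
private theorem abs_intCast_le_sum_abs (m : Fin g → ℤ) (j : Fin g) :
    |(m j : ℝ)| ≤ ∑ i, |(m i : ℝ)| :=
  Finset.single_le_sum (f := fun i => |(m i : ℝ)|) (fun _ _ => abs_nonneg _) (Finset.mem_univ j)

/-- `‖mⱼ + aⱼ‖ ≤ (1 + ‖aⱼ‖) exp(Σᵢ|mᵢ|)`. [folklore] -/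
private theorem norm_intCast_add_le (a : Fin g → ℂ) (m : Fin g → ℤ) (j : Fin g) :
    ‖(m j : ℂ) + a j‖ ≤ (1 + ‖a j‖) * rexp (∑ i, |(m i : ℝ)|) := by
  have hS : 0 ≤ ∑ i, |(m i : ℝ)| := Finset.sum_nonneg fun _ _ => abs_nonneg _
  have h1 : ‖(m j : ℂ)‖ ≤ ∑ i, |(m i : ℝ)| := by
    rw [← Complex.ofReal_intCast, Complex.norm_real, Real.norm_eq_abs]
    exact abs_intCast_le_sum_abs m j
  have h2 : ∑ i, |(m i : ℝ)| + 1 ≤ rexp (∑ i, |(m i : ℝ)|) := Real.add_one_le_exp _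
  calc ‖(m j : ℂ) + a j‖ ≤ ‖(m j : ℂ)‖ + ‖a j‖ := norm_add_le _ _
    _ ≤ ∑ i, |(m i : ℝ)| + ‖a j‖ := by linarith
    _ ≤ (1 + ‖a j‖) * rexp (∑ i, |(m i : ℝ)|) := by nlinarith [norm_nonneg (a j)]

/-- **The weight `(2πi ᵗ(m+a)u)ⁿ` has exponential-linear growth**:
`‖(2πi Σᵢ(mᵢ+aᵢ)uᵢ)ⁿ‖ ≤ (2π Σᵢ (1+‖aᵢ‖)‖uᵢ‖)ⁿ · exp(n Σᵢ|mᵢ|)` (so the weighted-series lemmas of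
`RiemannThetaHeatEquation` apply to it; the polynomial growth of the coefficients of a theta series
with a polynomial inserted, Lange–Birkenhake Prop. 3.3.6/3.3.7). [cite: LangeBirkenhake1992, §3.3.2 Prop. 3.3.6] -/
theorem norm_lineWeightPow_le (a u : Fin g → ℂ) (n : ℕ) (m : Fin g → ℤ) :
    ‖(fun m : Fin g → ℤ => (2 * π * I * ∑ i, ((m i : ℂ) + a i) * u i) ^ n) m‖ ≤
      (2 * π * ∑ i, (1 + ‖a i‖) * ‖u i‖) ^ n * rexp (n * ∑ i, |(m i : ℝ)|) := by
  have h2πI : ‖(2 * π * I : ℂ)‖ = 2 * π := by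
    rw [norm_mul, norm_mul, Complex.norm_I, mul_one, Complex.norm_ofNat, Complex.norm_real,
      Real.norm_of_nonneg Real.pi_pos.le]
  have h2π : (0 : ℝ) ≤ 2 * π := by positivity
  -- the first power
  have h1 : ‖2 * π * I * ∑ i, ((m i : ℂ) + a i) * u i‖ ≤
      (2 * π * ∑ i, (1 + ‖a i‖) * ‖u i‖) * rexp (∑ i, |(m i : ℝ)|) := by
    rw [norm_mul, h2πI]
    have hsum : ‖∑ i, ((m i : ℂ) + a i) * u i‖ ≤ (∑ i, (1 + ‖a i‖) * ‖u i‖) * rexp (∑ i, |(m i : ℝ)|) :=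
      calc ‖∑ i, ((m i : ℂ) + a i) * u i‖ ≤ ∑ i, ‖((m i : ℂ) + a i) * u i‖ := norm_sum_le _ _
        _ ≤ ∑ i, (1 + ‖a i‖) * rexp (∑ j, |(m j : ℝ)|) * ‖u i‖ :=
            Finset.sum_le_sum fun i _ => by
              rw [norm_mul]
              exact mul_le_mul_of_nonneg_right (norm_intCast_add_le a m i) (norm_nonneg _)
        _ = (∑ i, (1 + ‖a i‖) * ‖u i‖) * rexp (∑ i, |(m i : ℝ)|) := by
            rw [Finset.sum_mul]
            exact Finset.sum_congr rfl fun i _ => by ring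
    calc 2 * π * ‖∑ i, ((m i : ℂ) + a i) * u i‖
        ≤ 2 * π * ((∑ i, (1 + ‖a i‖) * ‖u i‖) * rexp (∑ i, |(m i : ℝ)|)) :=
          mul_le_mul_of_nonneg_left hsum h2π
      _ = (2 * π * ∑ i, (1 + ‖a i‖) * ‖u i‖) * rexp (∑ i, |(m i : ℝ)|) := by ring
  simp only
  rw [norm_pow, Real.exp_nat_mul, ← mul_pow]
  exact pow_le_pow_left₀ (norm_nonneg _) h1 n

/-! ### Differentiating the weighted series along the line -/

/-- **`d/ds Σ_m (2πi ᵗ(m+a)u)ⁿ e_m(s u) = Σ_m (2πi ᵗ(m+a)u)ⁿ⁺¹ e_m(s u)`** for the general term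
`e_m(z) = exp(πi ᵗ(m+a)Ω(m+a) + 2πi ᵗ(m+a)(z+b))` (symmetric `Ω`, `Im Ω ≥ c > 0`): the tree's termwise
`z`-derivative `fderiv_tsum_mul_riemannThetaCharTerm_apply` in the direction `u`, through the line
`s ↦ s·u`. [cite: LangeBirkenhake1992, §3.3.2 Prop. 3.3.7] -/
theorem hasDerivAt_tsum_lineWeightPow_mul_riemannThetaCharTerm (Ω : Matrix (Fin g) (Fin g) ℂ)
    (hΩ : ∀ i j, Ω i j = Ω j i) {c : ℝ} (hc : 0 < c)
    (hY : ∀ x : Fin g → ℝ, c * ∑ i, x i ^ 2 ≤ ∑ i, ∑ j, x i * (Ω i j).im * x j)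
    (a b u : Fin g → ℂ) (n : ℕ) (s : ℂ) :
    HasDerivAt (fun s : ℂ => ∑' m : Fin g → ℤ,
        (2 * π * I * ∑ i, ((m i : ℂ) + a i) * u i) ^ n * riemannThetaCharTerm a b Ω (s • u) m)
      (∑' m : Fin g → ℤ,
        (2 * π * I * ∑ i, ((m i : ℂ) + a i) * u i) ^ (n + 1) * riemannThetaCharTerm a b Ω (s • u) m) s := by
  set w : (Fin g → ℤ) → ℂ := fun m => (2 * π * I * ∑ i, ((m i : ℂ) + a i) * u i) ^ n with hw
  have hwb := norm_lineWeightPow_le a u n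
  set F : (Fin g → ℂ) → ℂ := fun z => ∑' m, w m * riemannThetaCharTerm a b Ω z m with hF
  -- `F` is differentiable at `s • u` with the termwise derivative
  have hFd : DifferentiableAt ℂ F (s • u) :=
    differentiableAt_tsum_mul_riemannThetaCharTerm Ω hΩ hc hY w hwb a b (s • u)
  have hline : HasDerivAt (fun s : ℂ => s • u) u s := by
    simpa using (hasDerivAt_id s).smul_const u
  have hcomp : HasDerivAt (F ∘ fun s : ℂ => s • u) (fderiv ℂ F (s • u) u) s :=
    hFd.hasFDerivAt.comp_hasDerivAt s hline
  have hval : fderiv ℂ F (s • u) u = ∑' m : Fin g → ℤ,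
      (2 * π * I * ∑ i, ((m i : ℂ) + a i) * u i) ^ (n + 1) * riemannThetaCharTerm a b Ω (s • u) m := by
    rw [hF, fderiv_tsum_mul_riemannThetaCharTerm_apply Ω hΩ hc hY w hwb a b (s • u) u]
    refine tsum_congr fun m => ?_
    rw [hw, pow_succ]
    ring
  rw [hval] at hcomp
  exact hcomp

/-! ### The `n`-th derivative along the line -/

/-- **`(d/ds)ⁿ ϑ[a; b](s u, Ω) = Σ_m (2πi ᵗ(m+a)u)ⁿ exp(πi ᵗ(m+a)Ω(m+a) + 2πi ᵗ(m+a)(s u + b))`** for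
symmetric `Ω` with `Im Ω ≥ c > 0`, all `a, b, u ∈ ℂ^g`, `n ∈ ℕ` and `s ∈ ℂ` — Lange–Birkenhake
Prop. 3.3.7 ("As it is a holomorphic function, we can differentiate the series term by term"),
iterated `n` times in the direction `u`. [cite: LangeBirkenhake1992, §3.3.2 Prop. 3.3.7] -/
theorem iteratedDeriv_riemannThetaChar_line (Ω : Matrix (Fin g) (Fin g) ℂ)
    (hΩ : ∀ i j, Ω i j = Ω j i) {c : ℝ} (hc : 0 < c)
    (hY : ∀ x : Fin g → ℝ, c * ∑ i, x i ^ 2 ≤ ∑ i, ∑ j, x i * (Ω i j).im * x j)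
    (a b u : Fin g → ℂ) (n : ℕ) :
    iteratedDeriv n (fun s : ℂ => riemannThetaChar a b Ω (s • u)) = fun s => ∑' m : Fin g → ℤ,
      (2 * π * I * ∑ i, ((m i : ℂ) + a i) * u i) ^ n * riemannThetaCharTerm a b Ω (s • u) m := by
  induction n with
  | zero =>
      funext s
      simp only [iteratedDeriv_zero, pow_zero, one_mul, riemannThetaChar_def]
  | succ n ih =>
      rw [iteratedDeriv_succ, ih]
      funext s
      exact (hasDerivAt_tsum_lineWeightPow_mul_riemannThetaCharTerm Ω hΩ hc hY a b u n s).deriv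

/-- **The theta series with the polynomial `(2πi ᵗ(m+a)u)ⁿ` inserted** is the `n`-th derivative at
`s = 0` of `s ↦ ϑ[a; b](s u, Ω)`:
`(d/ds)ⁿ ϑ[a;b](s u, Ω)|_{s=0} = Σ_m (2πi ᵗ(m+a)u)ⁿ exp(πi ᵗ(m+a)Ω(m+a) + 2πi ᵗ(m+a) b)`
(symmetric `Ω`, `Im Ω ≥ c > 0`).  For `g = 2`, `Ω = τ·B` the Gram matrix of the norm form on an ideal
`ℤb₁ + ℤb₂` of an imaginary quadratic field and `u = (σ(b₁), σ(b₂))`, this is Hecke's binary theta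
series with the spherical polynomial `σ(x)ⁿ` (up to the factor `(2πi)ⁿ`).
[cite: LangeBirkenhake1992, §3.3.2 Prop. 3.3.7] [cite: Hecke1926Modulfunktionen, §3] -/
theorem iteratedDeriv_riemannThetaChar_line_zero (Ω : Matrix (Fin g) (Fin g) ℂ)
    (hΩ : ∀ i j, Ω i j = Ω j i) {c : ℝ} (hc : 0 < c)
    (hY : ∀ x : Fin g → ℝ, c * ∑ i, x i ^ 2 ≤ ∑ i, ∑ j, x i * (Ω i j).im * x j)
    (a b u : Fin g → ℂ) (n : ℕ) :
    iteratedDeriv n (fun s : ℂ => riemannThetaChar a b Ω (s • u)) 0 = ∑' m : Fin g → ℤ,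
      (2 * π * I * ∑ i, ((m i : ℂ) + a i) * u i) ^ n * riemannThetaCharTerm a b Ω 0 m := by
  rw [iteratedDeriv_riemannThetaChar_line Ω hΩ hc hY a b u n]
  simp only [zero_smul]

/-- The series of `iteratedDeriv_riemannThetaChar_line` converges absolutely. [cite: LangeBirkenhake1992, §3.3.2 Prop. 3.3.6] -/
theorem summable_norm_lineWeightPow_mul_riemannThetaCharTerm (Ω : Matrix (Fin g) (Fin g) ℂ)
    (hΩ : ∀ i j, Ω i j = Ω j i) {c : ℝ} (hc : 0 < c)
    (hY : ∀ x : Fin g → ℝ, c * ∑ i, x i ^ 2 ≤ ∑ i, ∑ j, x i * (Ω i j).im * x j)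
    (a b u z : Fin g → ℂ) (n : ℕ) :
    Summable fun m : Fin g → ℤ =>
      ‖(2 * π * I * ∑ i, ((m i : ℂ) + a i) * u i) ^ n * riemannThetaCharTerm a b Ω z m‖ :=
  summable_norm_mul_riemannThetaCharTerm Ω hΩ hc hY
    (fun m => (2 * π * I * ∑ i, ((m i : ℂ) + a i) * u i) ^ n) (norm_lineWeightPow_le a u n) a b z

/-- `HasSum` form of `iteratedDeriv_riemannThetaChar_line_zero`:
`∂ⁿ_s ϑ[a; b](s u, Ω)|₀ = Σ_m (2πi ᵗ(m+a)u)ⁿ T[a; b](Ω, 0)(m)` (for `n = 1` this is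
`RiemannThetaGradient.hasSum_fderiv_riemannThetaChar_apply` at `z = 0`).
[cite: LangeBirkenhake1992, §3.3.2 Prop. 3.3.6] -/
theorem hasSum_iteratedDeriv_riemannThetaChar_line (Ω : Matrix (Fin g) (Fin g) ℂ)
    (hΩ : ∀ i j, Ω i j = Ω j i) {c : ℝ} (hc : 0 < c)
    (hY : ∀ x : Fin g → ℝ, c * ∑ i, x i ^ 2 ≤ ∑ i, ∑ j, x i * (Ω i j).im * x j)
    (a b u : Fin g → ℂ) (n : ℕ) :
    HasSum (fun m : Fin g → ℤ =>
        (2 * π * I * ∑ i, ((m i : ℂ) + a i) * u i) ^ n * riemannThetaCharTerm a b Ω 0 m)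
      (iteratedDeriv n (fun s : ℂ => riemannThetaChar a b Ω (s • u)) 0) := by
  rw [iteratedDeriv_riemannThetaChar_line_zero Ω hΩ hc hY a b u n]
  exact (summable_norm_lineWeightPow_mul_riemannThetaCharTerm Ω hΩ hc hY a b u 0 n).of_norm.hasSum

/-! ### Parity -/

/-- **Parity of the line derivatives**: `∂ⁿ_s ϑ[a; b](s u, Ω)|₀ = (-1)ⁿ ∂ⁿ_s ϑ[-a; -b](s u, Ω)|₀`,
from `ϑ[a; b](-z) = ϑ[-a; -b](z)`. [cite: MumfordTata1, Ch. II §1] -/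
theorem iteratedDeriv_riemannThetaChar_line_eq_neg_char (a b : Fin g → ℂ)
    (Ω : Matrix (Fin g) (Fin g) ℂ) (u : Fin g → ℂ) (n : ℕ) :
    iteratedDeriv n (fun s : ℂ => riemannThetaChar a b Ω (s • u)) 0 =
      (-1) ^ n * iteratedDeriv n (fun s : ℂ => riemannThetaChar (-a) (-b) Ω (s • u)) 0 := by
  have hfun : (fun s : ℂ => riemannThetaChar a b Ω (s • u)) =
      fun s => (fun t : ℂ => riemannThetaChar (-a) (-b) Ω (t • u)) (-s) := by
    funext s; simp only [neg_smul, riemannThetaChar_neg, neg_neg]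
  rw [hfun, iteratedDeriv_comp_neg n (fun t : ℂ => riemannThetaChar (-a) (-b) Ω (t • u)) 0, neg_zero,
    smul_eq_mul]

/-- **The odd line derivatives of the even function `ϑ[0; 0](·, Ω)` vanish at `0`**:
`∂ⁿ_s ϑ[0; 0](s u, Ω)|₀ = 0` for odd `n` (for `n = 1`: the gradient of `ϑ[0;0]` at `0` is `0`).
[cite: MumfordTata1, Ch. II §1] -/
theorem iteratedDeriv_riemannThetaChar_zero_zero_line_eq_zero (Ω : Matrix (Fin g) (Fin g) ℂ)
    (u : Fin g → ℂ) {n : ℕ} (hn : Odd n) :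
    iteratedDeriv n (fun s : ℂ => riemannThetaChar 0 0 Ω (s • u)) 0 = 0 := by
  have h := iteratedDeriv_riemannThetaChar_line_eq_neg_char 0 0 Ω u n
  rw [neg_zero, hn.neg_one_pow, neg_one_mul] at h
  linear_combination h / 2

end Literature.Analysis.SpecialFunctions

end
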